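import Mathlib
import Summits.MatrixMultiplication.MatrixMultiplication.Theses.LevelGradedCohnUmans
import Summits.MatrixMultiplication.MatrixMultiplication.Theorems.GradedPricing.Negative.LoadBearing
import Summits.MatrixMultiplication.MatrixMultiplication.Theorems.GradedPricing.Negative.LeftInvariance
import Literature.Computability.AlgebraicComplexity.GroupAlgebraTensor
import Literature.Computability.AlgebraicComplexity.SchoenhageTau
import Literature.Computability.AlgebraicComplexity.AsymptoticSpectrum
import Literature.RepresentationTheory.FiniteGroups.WedderburnBlocks
import Literature.Computability.AlgebraicComplexity.AsymptoticSumInequalityAsymptoticRank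
import Literature.Barriers.MatrixMultiplication.UniversalMethodBarrierAsymptoticRank
import Literature.Computability.AlgebraicComplexity.AsymptoticRankLimit
import Literature.Computability.AlgebraicComplexity.CohnUmansTPPProofs

/-!
# Line `asymptotic-rank-sandwich` — skeleton for crux `LevelGradedCohnUmans.GradedPricing`
# (stmt-MatrixMultiplication-7611, route-MatrixMultiplication-LevelGradedCohnUmans, rank 2)

See `Lines/asymptotic-rank-sandwich.md` (the line card) for the prose: idea, stubs, hardest stub,
barriers, Disproof used, triage answers.

Shape: three registered stubs, each admitted (`sorry`) with its full signature over existing tree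
declarations — `stub_blockVisibility` (a bi-invariant `J` whose read-out touches Wedderburn block `i`
contains the block character `χᵢ`), `stub_gradedRestriction` (a `J`-separated triple is a RESTRICTION
of the sub-direct-sum `⊕_{i ∈ S} ⟨dᵢ,dᵢ,dᵢ⟩` over any `S` containing the blocks whose character lies in
`J` — HARDEST, the only piece of the line not yet proved anywhere) and `stub_directSumUpperValue` (the
upper value `R̃(⊕ᵢ⟨dᵢ,dᵢ,dᵢ⟩) ≤ Σᵢ dᵢ^ω` of the asymptotic rank, the lever of the card, PROVED in
`Cruxes/GradedPricing/SketchIdeator2.lean` as `asymptoticRank_matMulDirectSum_le`) — and the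
composition `GradedPricing_of : …Theses.LevelGradedCohnUmans.GradedPricing` (no `sorry` of its own: it
invokes the three stubs in its first three lines and is otherwise a real ≈ 40-line proof over the proved
glue lemmas below; with the stubs replaced by hypotheses it is sorry-free with axioms
{propext, Classical.choice, Quot.sound} — planner evidence `compose-hyps-check.lean`), which concludes
the crux decl BY NAME:

  `(|X||Y||Z|)^{ω/3} ≤ R̃(⟨X,Y,Z⟩)`            (one-summand asymptotic sum inequality, tree,
                                                 `rpow_omega_le_asymptoticRank_matMulTensorOn` below)
  `            ≤ R̃(⊕_{i∈S} ⟨dᵢ,dᵢ,dᵢ⟩)`       (stub 2 ∘ stub 1, and `R̃`-monotonicity under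
                                                 restriction, tree `asymptoticRank_le_of_polyDegeneratesTo`)
  `            ≤ Σ_{i∈S} dᵢ^ω`                  (stub 3)
  `            ≤ Σᶠ_{χ ∈ Irr G ∩ J} χ(1)^ω`      (`S = {i | χᵢ ∈ J}`: distinct irreducible characters,
                                                 `sum_blockDegrees_rpow_le_finsum` below, proved).

No group-side tensor powers, no `ε`, no AlgEquiv: all limits live inside the tree's `asymptoticRank`
lemmas (this is the delta against the route's foreseen `BlockAsymptotics`).  Bi-invariance enters ONLY
through stub 1 (cf. `Negative.gradedPricing_false_without_biInv`, `…_with_leftInv_only`), both halves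
of the separation pattern ONLY through stub 2 (cf. `Negative.gradedPricing_false_without_ones/_zeros`);
every step is `≤` with constant `1` (cf. `Negative.gradedPricing_attained`, `not_gradedPricing_strict`).
-/

noncomputable section

open scoped BigOperators
open Literature.Computability.AlgebraicComplexity Literature.RepresentationTheory.FiniteGroups
open Literature.Barriers.MatrixMultiplication (asymptoticRank_le_of_polyDegeneratesTo)

namespace Summit.MatrixMultiplication.MatrixMultiplication.Cruxes.GradedPricing.AsymptoticRankSandwich

/-! ## The three stubs -/

/-- **Stub 1 — block visibility (membership).**  For a finite group `G` with Wedderburn coordinates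
`φ : ℂ[G] ≃ₐ ∏ᵢ ℂ^{dᵢ×dᵢ}` and a BI-INVARIANT subspace `J ≤ ℂ^G`: if the read-out functional
`w ↦ Σ_g (φ⁻¹ w)_g · f(g)` of some `f ∈ J` does not vanish on the `i`-th block (at some `Pi.single i M`),
then the block character `χᵢ = tr (φ ·)ᵢ` lies in `J`.
Why plausibly true: bi-invariance makes the annihilator of `J` a TWO-SIDED ideal of `ℂ[G]`; two-sided
ideals of `∏ ℂ^{dᵢ×dᵢ}` are coordinate sub-products (`SketchIdeator2.twoSidedIdeal_blockAlgebra_eq_subproduct`,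
proved); the unit of a touched block transports back to a multiple of `χᵢ`.  Concretely it is the kernel
dichotomy of card `matrix-unit-sandwich`, PROVED in `SketchIdeator1.character_mem_of_fourierCoeff_ne_zero`
for matrix units `M = E_{ab}` (generalized bi-translates `g ↦ f̃(E_{ac} · g · E_{cb}) ∈ J`,
`Σ_c F_c = f̃(E_{ab}) · χᵢ`); a general `M = Σ_{ab} M_{ab} E_{ab}` touches some matrix unit by linearity
of the read-out in `w`.  Uses bi-invariance two-sidedly (left-invariance alone is refuted:
`Negative.gradedPricing_false_with_leftInv_only`); it is the ONLY place the line consumes invariance of `J`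
(`Negative.gradedPricing_false_without_biInv`).  Size: M (≈ 120 lines incl. the pairing lemmas). -/
theorem stub_blockVisibility {G : Type} [Group G] [Fintype G] {r : ℕ} {d : Fin r → ℕ}
    [∀ i, NeZero (d i)] (φ : MonoidAlgebra ℂ G ≃ₐ[ℂ] BlockAlgebraC d) (J : Submodule ℂ (G → ℂ))
    (hJ : ∀ f ∈ J, ∀ a b : G, (fun g : G => f (a * g * b)) ∈ J)
    {f : G → ℂ} (hf : f ∈ J) (i : Fin r) (M : Matrix (Fin (d i)) (Fin (d i)) ℂ)
    (hM : ∑ g, (φ.symm (Pi.single i M)).coeff g * f g ≠ 0) :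
    ((blockRep φ i).character : G → ℂ) ∈ J := by
  sorry

/-- **Stub 2 — graded restriction (HARDEST; the algebraic half of the crux, the only open piece).**
If every block touched by the read-out of some `f ∈ J` has its character in `J` (the conclusion of
stub 1, taken as the hypothesis `hvis` — no invariance of `J` is assumed here), then for every
`J`-SEPARATED triple `X, Y, Z ⊆ G` (route convention: words `x⁻¹ y y'⁻¹ z`, BOTH pattern halves —
`Negative.gradedPricing_false_without_ones/_zeros`) and every `S ⊇ {i | χᵢ ∈ J}`, the matrix
multiplication tensor `⟨X,Y,Z⟩` (rows `X`, inner `Y`, columns `Z`) is a restriction of the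
sub-direct-sum `⊕_{i ∈ S} ⟨dᵢ,dᵢ,dᵢ⟩`, reindexed by `Fin |S|` through `S.orderEmbOfFin rfl`.
Why plausibly true (paper proof): restriction maps `(x,y) ↦ (φ (x⁻¹y))|_S` (entries of the `S`-blocks),
`(y',z) ↦ (φ (y'⁻¹z))|_S`, `(x₀,z₀) ↦` the read-out of the separator `f_{x₀z₀}` on the matrix units of
the `S`-blocks; contracting against `matMulDirectSum` computes the read-out of `f_{x₀z₀}` on the `S`-part
of `φ(x⁻¹y)·φ(y'⁻¹z) = φ(x⁻¹y y'⁻¹z)`; blocks outside `S` have character outside `J`, hence are invisible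
to `f_{x₀z₀} ∈ J` by `hvis` (contrapositive), so this equals the full read-out
`Σ_h (φ⁻¹ φ (x⁻¹y y'⁻¹z))_h f(h) = f_{x₀z₀}(x⁻¹ y y'⁻¹ z) = [x = x₀ ∧ y = y' ∧ z = z₀]`, the entry of
`matMulTensorOn`.  The separation-to-`groupTensor` half is PROVED (`SketchIdeator2.sep_tensorRestrictsTo_groupTensor`,
(1a)); the `J = ⊤`, `S = univ` case is the tree's `structureTensor_restrictsTo_of_algEquiv` pattern.
Why it might fail: only by a slip of orientation — the read-out pairs block coordinates with `f` through
`φ.symm`, exactly the quantity `hvis` speaks about, so there is no dual-block flip (Disproof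
`whyItResists` §3); corners `X/Y/Z = ∅` give empty index types (vacuous), `S = ∅` forces every
separator to vanish identically, which contradicts the "ones" half unless `X × Z = ∅`.  Size: M–L
(≈ 150 lines: bilinearity of the contraction, `Finset.sum_sigma` over the block index, reindexing). -/
theorem stub_gradedRestriction {G : Type} [Group G] [Fintype G] [DecidableEq G] {r : ℕ}
    {d : Fin r → ℕ} [∀ i, NeZero (d i)] (φ : MonoidAlgebra ℂ G ≃ₐ[ℂ] BlockAlgebraC d)
    (J : Submodule ℂ (G → ℂ))
    (hvis : ∀ f ∈ J, ∀ (i : Fin r) (M : Matrix (Fin (d i)) (Fin (d i)) ℂ),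
      ∑ g, (φ.symm (Pi.single i M)).coeff g * f g ≠ 0 →
        ((blockRep φ i).character : G → ℂ) ∈ J)
    (X Y Z : Finset G)
    (hsep : ∀ x₀ ∈ X, ∀ z₀ ∈ Z, ∃ f ∈ J, ∀ x ∈ X, ∀ y ∈ Y, ∀ y' ∈ Y, ∀ z ∈ Z,
      (x = x₀ ∧ y = y' ∧ z = z₀ → f (x⁻¹ * y * y'⁻¹ * z) = 1) ∧
      (¬ (x = x₀ ∧ y = y' ∧ z = z₀) → f (x⁻¹ * y * y'⁻¹ * z) = 0))
    (S : Finset (Fin r)) (hS : ∀ i, ((blockRep φ i).character : G → ℂ) ∈ J → i ∈ S) :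
    TensorRestrictsTo
      (matMulDirectSum ℂ (fun j : Fin S.card => d (S.orderEmbOfFin rfl j))
        (fun j => d (S.orderEmbOfFin rfl j)) (fun j => d (S.orderEmbOfFin rfl j)))
      (matMulTensorOn ℂ X Y Z) := by
  sorry

/-- **Stub 3 — the upper value `R̃(⊕ᵢ ⟨dᵢ,dᵢ,dᵢ⟩) ≤ Σᵢ dᵢ^ω` (the lever of the card).**  With the
tree's lower bound `sum_rpow_omega_le_asymptoticRank` this is the identity `R̃(⊕ᵢ⟨dᵢ,dᵢ,dᵢ⟩) = Σᵢ dᵢ^ω`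
(the tree has only the one-summand case `asymptoticRank_matMulTensor`).
Why true: PROVED sorry-free in `Cruxes/GradedPricing/SketchIdeator2.lean`
(`asymptoticRank_matMulDirectSum_le`, ≈ 60 lines, standard axioms, paste-ready; elementary route
`R(D^{⊗N}) ≤ C_ε (Σ dᵢ^{ω+ε})^N` by `kroneckerPow_matMulDirectSum` + `tensorRank_blockPiTensor_le` +
`exists_tensorRank_matMulTensor_le_rpow`, `N`-th roots via `asymptoticRank_le_rpow`,
`le_of_pow_le_mul_pow`, then `ε → 0` by `le_of_forall_pos_le_sum_rpow`; alternative route by Strassen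
duality `strassen_duality_asymptoticRank_holds`).  Registered as a stub because it is the line's one
genuinely new tree lemma and should land on its own (`--supports`; natural home
Literature/…/AsymptoticRankMatMul), not be buried in the composition.  Size: M (done). -/
theorem stub_directSumUpperValue {r : ℕ} (d : Fin r → ℕ) [∀ i, NeZero (d i)] :
    asymptoticRank (matMulDirectSum ℂ d d d) ≤ ∑ i, (d i : ℝ) ^ omega ℂ := by
  sorry

/-! ## Glue (fully proved) -/

/-- Lower half of the sandwich: `(|α||β||γ|)^{ω/3} ≤ R̃(⟨α,β,γ⟩)` for arbitrary finite index types —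
the one-summand case of the tree's asymptotic sum inequality `sum_rpow_omega_le_asymptoticRank`,
transported along the relabelling `⊕_{Fin 1}⟨|α|,|β|,|γ|⟩ ≤ ⟨α,β,γ⟩` (`tensorRestrictsTo_precomp`)
by `R̃`-monotonicity. -/
theorem rpow_omega_le_asymptoticRank_matMulTensorOn {α β γ : Type} [Fintype α] [Fintype β]
    [Fintype γ] [DecidableEq α] [DecidableEq β] [DecidableEq γ] :
    ((Fintype.card α * Fintype.card β * Fintype.card γ : ℕ) : ℝ) ^ (omega ℂ / 3) ≤
      asymptoticRank (matMulTensorOn ℂ α β γ) := by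
  classical
  -- the one-summand direct sum `⊕_{Fin 1} ⟨|α|,|β|,|γ|⟩` is a relabelling of `matMulTensorOn ℂ α β γ`
  have hres : TensorRestrictsTo (matMulTensorOn ℂ α β γ)
      (matMulDirectSum ℂ (fun _ : Fin 1 => Fintype.card α) (fun _ => Fintype.card β)
        (fun _ => Fintype.card γ)) := by
    set eα := Fintype.equivFin α
    set eβ := Fintype.equivFin β
    set eγ := Fintype.equivFin γ
    have key : matMulDirectSum ℂ (fun _ : Fin 1 => Fintype.card α) (fun _ => Fintype.card β)
        (fun _ => Fintype.card γ) =
        fun x y z => matMulTensorOn ℂ α β γ (eα.symm x.2.1, eγ.symm x.2.2)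
          (eα.symm y.2.1, eβ.symm y.2.2) (eβ.symm z.2.1, eγ.symm z.2.2) := by
      funext x y z
      simp only [matMulDirectSum, matMulTensorOn_apply]
      refine ite_congr_prop ?_
      simp only [Subsingleton.elim x.1 y.1, Subsingleton.elim y.1 z.1, true_and, Fin.ext_iff,
        Equiv.apply_eq_iff_eq]
    rw [key]
    exact tensorRestrictsTo_precomp _ _ _ _
  have h1 := sum_rpow_omega_le_asymptoticRank ℂ (fun _ : Fin 1 => Fintype.card α)
    (fun _ => Fintype.card β) (fun _ => Fintype.card γ)
  simp only [Finset.univ_unique, Finset.sum_singleton] at h1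
  exact h1.trans (asymptoticRank_le_of_polyDegeneratesTo hres.polyDegeneratesTo)

/-- THE SANDWICH given the upper value (= the route's foreseen `BlockAsymptotics`, for arbitrary
finite row/inner/column types): `(|α||β||γ|)^{ω/3} ≤ R̃(⟨α,β,γ⟩) ≤ R̃(⊕ᵢ⟨dᵢ,dᵢ,dᵢ⟩) ≤ Σᵢ dᵢ^ω`.
Stated with the upper value as the hypothesis `hup`, so that this lemma is sorry-free. -/
theorem rpow_omega_le_of_restrictsTo {r : ℕ} {d : Fin r → ℕ}
    (hup : asymptoticRank (matMulDirectSum ℂ d d d) ≤ ∑ i, (d i : ℝ) ^ omega ℂ)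
    {α β γ : Type} [Fintype α] [Fintype β] [Fintype γ] [DecidableEq α] [DecidableEq β]
    [DecidableEq γ] (h : TensorRestrictsTo (matMulDirectSum ℂ d d d) (matMulTensorOn ℂ α β γ)) :
    ((Fintype.card α * Fintype.card β * Fintype.card γ : ℕ) : ℝ) ^ (omega ℂ / 3) ≤
      ∑ i, (d i : ℝ) ^ omega ℂ :=
  rpow_omega_le_asymptoticRank_matMulTensorOn.trans
    ((asymptoticRank_le_of_polyDegeneratesTo h.polyDegeneratesTo).trans hup)

/-- BUDGET: blocks with character in `J` are pairwise distinct irreducible characters lying in `J`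
(`character_blockRep_injective`, `isIrreducible_blockRep`, `irrChars_finite_holds`), so
`Σ_{i ∈ S} dᵢ^s ≤ Σᶠ_{χ ∈ Irr(G) ∩ J} χ(1)^s`. -/
theorem sum_blockDegrees_rpow_le_finsum {G : Type} [Group G] [Fintype G]
    {r : ℕ} {d : Fin r → ℕ} [∀ i, NeZero (d i)] (φ : MonoidAlgebra ℂ G ≃ₐ[ℂ] BlockAlgebraC d)
    (J : Submodule ℂ (G → ℂ)) (S : Finset (Fin r))
    (hS : ∀ i ∈ S, ((blockRep φ i).character : G → ℂ) ∈ J) (s : ℝ) :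
    ∑ i ∈ S, (d i : ℝ) ^ s ≤
      ∑ᶠ χ ∈ irrChars G ∩ (J : Set (G → ℂ)), (χ 1).re ^ s := by
  classical
  have hfin : (irrChars G ∩ (J : Set (G → ℂ))).Finite :=
    (irrChars_finite_holds G).subset Set.inter_subset_left
  rw [finsum_mem_eq_finite_toFinset_sum _ hfin]
  set χ : Fin r → (G → ℂ) := fun i => (blockRep φ i).character with hχ
  have hinj : Function.Injective χ := character_blockRep_injective φ
  have hmem : ∀ i ∈ S, χ i ∈ hfin.toFinset := fun i hi => by
    rw [Set.Finite.mem_toFinset]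
    exact ⟨⟨Fin (d i) → ℂ, inferInstance, inferInstance, inferInstance, blockRep φ i,
      isIrreducible_blockRep φ i, rfl⟩, hS i hi⟩
  have hdeg : ∀ i, ((χ i 1).re : ℝ) = d i := fun i => by
    simp [hχ, Representation.char_one]
  calc ∑ i ∈ S, (d i : ℝ) ^ s = ∑ ψ ∈ S.image χ, (ψ 1).re ^ s := by
        rw [Finset.sum_image fun i _ j _ h => hinj h]
        exact Finset.sum_congr rfl fun i _ => by rw [hdeg]
    _ ≤ ∑ ψ ∈ hfin.toFinset, (ψ 1).re ^ s := by
        refine Finset.sum_le_sum_of_subset_of_nonneg (fun ψ hψ => ?_) (fun ψ hψ _ => ?_)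
        · obtain ⟨i, hi, rfl⟩ := Finset.mem_image.1 hψ
          exact hmem i hi
        · rw [Set.Finite.mem_toFinset] at hψ
          obtain ⟨dψ, -, hdψ⟩ := IsIrrChar.exists_apply_one (G := G) hψ.1
          rw [hdψ]
          exact Real.rpow_nonneg (by simp) _

/-! ## Composition: the three stubs conclude the crux BY NAME -/

/-- **Composition.**  Take Wedderburn coordinates `φ` (`exists_algEquiv_pi_matrix`) and
`S := {i | χᵢ ∈ J}`; stub 1 (fed the bi-invariance) discharges the visibility hypothesis of stub 2 (fed
the separation), giving `⟨X,Y,Z⟩ ≤ ⊕_{i∈S}⟨dᵢ,dᵢ,dᵢ⟩`; the sandwich (stub 3 + tree) prices it by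
`Σ_{i∈S} dᵢ^ω`, and the budget lemma bounds that by the graded character sum.  The stubs enter only
at the three marked lines (`STUB 1/2/3`); everything else is proved (with the stubs as hypotheses the
same proof is sorry-free, axioms {propext, Classical.choice, Quot.sound}: planner evidence
`compose-hyps-check.lean`). -/
theorem GradedPricing_of :
    Summit.MatrixMultiplication.MatrixMultiplication.Theses.LevelGradedCohnUmans.GradedPricing := by
  intro G _ _ J hJ X Y Z hsep
  classical
  obtain ⟨r, d, hd, ⟨φ⟩⟩ := exists_algEquiv_pi_matrix G
  haveI := hd
  set S : Finset (Fin r) :=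
    Finset.univ.filter (fun i => ((blockRep φ i).character : G → ℂ) ∈ J) with hSdef
  have hS : ∀ i, i ∈ S ↔ ((blockRep φ i).character : G → ℂ) ∈ J := fun i => by simp [hSdef]
  -- STUB 1: bi-invariance ⇒ visibility
  have hvis : ∀ f ∈ J, ∀ (i : Fin r) (M : Matrix (Fin (d i)) (Fin (d i)) ℂ),
      ∑ g, (φ.symm (Pi.single i M)).coeff g * f g ≠ 0 →
        ((blockRep φ i).character : G → ℂ) ∈ J :=
    fun f hf i M hM => stub_blockVisibility φ J hJ hf i M hM
  -- STUB 2: separation ⇒ restriction of the visible sub-direct-sum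
  have hres := stub_gradedRestriction φ J hvis X Y Z hsep S (fun i hi => (hS i).2 hi)
  -- STUB 3 + tree: the sandwich
  have h2 := rpow_omega_le_of_restrictsTo
    (stub_directSumUpperValue (fun j : Fin S.card => d (S.orderEmbOfFin rfl j))) hres
  -- (nothing below is admitted)
  have hsum : ∑ j : Fin S.card, ((d (S.orderEmbOfFin rfl j) : ℕ) : ℝ) ^ omega ℂ =
      ∑ i ∈ S, (d i : ℝ) ^ omega ℂ := by
    rw [← Finset.sum_coe_sort S]
    exact Fintype.sum_equiv (S.orderIsoOfFin rfl).toEquiv _ _ fun j => by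
      simp only [RelIso.coe_fn_toEquiv, Finset.coe_orderIsoOfFin_apply]
  -- budget
  have h3 := sum_blockDegrees_rpow_le_finsum φ J S (fun i hi => (hS i).1 hi) (omega ℂ)
  simp only [Fintype.card_coe] at h2
  rw [hsum] at h2
  exact h2.trans h3

/-! ## Checks against the landed Negative lemmas of this crux (importable; nothing to prove)

Bi-invariance is consumed only by stub 1 (two-sidedly), both halves of the separation pattern only by
stub 2, and every inequality above has constant `1`; the skeleton imports and names the landed
negative-side theorems it is measured against. -/

example := @Summit.MatrixMultiplication.MatrixMultiplication.Theorems.GradedPricing.Negative.gradedPricing_false_without_biInv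
example := @Summit.MatrixMultiplication.MatrixMultiplication.Theorems.GradedPricing.Negative.gradedPricing_false_without_ones
example := @Summit.MatrixMultiplication.MatrixMultiplication.Theorems.GradedPricing.Negative.gradedPricing_false_without_zeros
example := @Summit.MatrixMultiplication.MatrixMultiplication.Theorems.GradedPricing.Negative.gradedPricing_false_with_leftInv_only
example := @Summit.MatrixMultiplication.MatrixMultiplication.Theorems.GradedPricing.Negative.gradedPricing_attained
example := @Summit.MatrixMultiplication.MatrixMultiplication.Theorems.GradedPricing.Negative.not_gradedPricing_strict

end Summit.MatrixMultiplication.MatrixMultiplication.Cruxes.GradedPricing.AsymptoticRankSandwich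

end
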